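import Summits.ValiantsHypothesis.ValiantsHypothesis.Theorems.TwoProducts.RankThreeAffineToricWronskianDepthForm

/-!
# Toric Wronskians of monomials, part 9: MERGE-FREE families keep the pair directions of `u` — the K-free count (W4c)

Sequel of ✓ `…ToricWronskianDepth` (W4a, p721689), `…ToricWronskianDepthNewton`/`…DepthForm` (W4b: `toricW_layer_closed_form`, the hybrid Vandermonde).
THIS FILE closes the no-merge programme of val-idea-crit-8 g6 VERDICT #118 (c): ★★ `toricW_Eset_subset_Xc_of_mergeFree`: for a MERGE-FREE pair
`(u, e)`, every edge direction (in the chart `σ`) of the toric Wronskian `W_{J(·,u)}(X^{e_0},…,X^{e_{K−1}})` lies in the exceptional set ✓ `Xc σ u` of the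
carrier (crossing values of pairs of non-zero support points and axis values) — INDEPENDENTLY of `K` and of the exponents; hence ★ `toricW_card_Eset_le_of_mergeFree`:
`|Eset σ W| ≤ t² + t` for a `t`-sparse `u` (✓ `card_Xc_le`), the K-FREE COUNT.  Compare ✓ (W1) `toricW_Eset_ray_subset` (one class, p711636) and ✓ (W2)
`toricW_Eset_subset_of_generic_S1` (no resonance, p715762): here arbitrary resonance classes are allowed, merges are excluded.
MERGE-FREE (★ `MergeFree u e`, the one new `Prop`-definition of the W4 files, strong K-uniform form): for all non-zero support vectors `v, p` of `u` with
`det(p, v) ≠ 0` and all columns `i, j` NOT resonant at `v`: `det(e_j, v) − det(e_i, v) + k·det(p, v) ≠ 0` for every integer `|k| < K` (#118's merge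
`det(e_{i′} − e_i − j•p, v) = 0`, `|j| <` class size, forbidden here for all `|k| < K` and all pairs `(v,p)` — a genericity condition on `(supp u, e)` only).
PROOF of the inclusion, for a chart value `μ ∉ Xc σ u`, `ν = dir σ μ`: normalise `u ↦ u − u(0)` (✓ `jacDer_sub_C`; `u − u(0) = 0` ⇒ no edge direction by
✓ `toricW_Eset_subset_of_generic`); outside `Xc σ u` the points of `supp(u − u(0)) ⊆ S1 u` have pairwise DISTINCT weights (`eq_of_wt_eq_of_notMem_Xc`), so
there is a unique top `v ≠ 0` (✓ `exists_isUniqueTop_of_not_isEdgeDir`); `W ≠ 0` forces pairwise distinct columns (`toricW_eq_zero_of_eq`).  Case A, no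
two columns resonant at `v`: ✓ `toricW_isUniqueTop_corner`.  Case B: ★★ `exists_toricW_classData` gives CANONICAL CLASS DATA at `v` — the primitive step
`q` (`v = g•q`, `gcd = 1`, via ★ `expo_sub_parallel`: `det(x − y, v) = 0 ⇒ x − y ∈ ℕq ∪ −ℕq`, integer Bezout), maximal multipliers `n_i` (`Nat.findGreatest`)
and bases `b_i = e_i − n_i•q` whose fibres are EXACTLY the resonance classes — so `d = toricWDefect b ≥ 1`; if every support point is collinear with `v`
then `W = 0` by ✓ `toricW_support_layer` (no word reaches depth `d`); otherwise `p :=` the heaviest support point OFF the line `ℝv` satisfies W4a's `hp2`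
strictly, `det(p,v) ≠ 0`, and ✓ `toricW_layer_closed_form` evaluates the coefficient at `Σe + m•v + d•p` as the hybrid Vandermonde whose in-class factors
are `u_p·(n_j − n_i)·det(q,p) ≠ 0` and whose cross factors `u_v·(det(e_j − e_i, v) + (ℓ_j − ℓ_i)det(p,v))` are `≠ 0` by merge-freeness (`|ℓ_j − ℓ_i| < K`);
✓ `toricW_isUniqueTop_layer` then makes that point the UNIQUE `ν`-top: `ν` is not an edge direction — contradiction.
WHAT THIS SAYS for (TW-flag, poly) (residue sentence rev 6): the hypothesis shape ✓ `TWFlagBound` holds with `Q = t² + t` on every merge-free `(u, e)`; the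
located residue is EXACTLY the merging configurations (val-idea-crit-8 g6 merge memo, `NOTE-crit8-g6-merge-memo.md`), which stay OPEN.  HONEST LABEL:
located cell / K-free count on the OPEN rung 3-AFF (side ladder, crux `stmt-ValiantsHypothesis-5906` `TwoProducts`); (TW-flag, poly) AT MERGES, `OLMLaw`,
`RankThreeAffineLaw(Exp)`, `TwoProducts`, PCB, `ResidualLawV25` UNMOVED; 0 summit distance; VP ≠ VNP is NOT proved; no summit statement is proved here.
`--supports stmt-ValiantsHypothesis-5906 --as helper` (val-port-4 g6; critic of record val-idea-crit-8 g6).  One new predicate (`MergeFree`); no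
instances, no notation, no named facts. [folklore]
-/

noncomputable section
set_option linter.dupNamespace false

namespace Summit.ValiantsHypothesis.ValiantsHypothesis.Theorems.TwoProducts.RankTwoJacobian

open scoped BigOperators
open MvPolynomial
open Literature.LinearAlgebra.Matrix (wronskianMatrix wronskian wronskianMatrix_apply wronskian_def)

section TowerKernel
open scoped Classical

/-! ### §1 Primitive vectors and canonical class data -/

/-- ★ THE LATTICE LEMMA: if `x − y` is parallel to `v ≠ 0` then `x` and `y` differ by a natural multiple of the primitive vector `q` of `v`
(given as `v = g • q` with `q 0, q 1` coprime). [folklore] -/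
theorem expo_sub_parallel {v q x y : Expo} {g : ℕ} (hg : 0 < g) (hv : v = g • q) (hcop : Nat.Coprime (q 0) (q 1))
    (h : idet x v = idet y v) : (∃ k : ℕ, x = y + k • q) ∨ (∃ k : ℕ, y = x + k • q) := by
  -- integer Bezout coefficients for the coprime coordinates of `q`
  obtain ⟨c₀, c₁, hbez⟩ : IsCoprime ((q 0 : ℕ) : ℤ) ((q 1 : ℕ) : ℤ) := Nat.isCoprime_iff_coprime.mpr hcop
  have h' : ((x 0 : ℕ) : ℤ) * (q 1 : ℕ) - ((x 1 : ℕ) : ℤ) * (q 0 : ℕ) = ((y 0 : ℕ) : ℤ) * (q 1 : ℕ) - ((y 1 : ℕ) : ℤ) * (q 0 : ℕ) := by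
    unfold idet at h
    rw [hv] at h
    simp only [Finsupp.smul_apply, smul_eq_mul, Nat.cast_mul] at h
    have hg' : ((g : ℕ) : ℤ) ≠ 0 := by exact_mod_cast hg.ne'
    have := mul_left_cancel₀ hg' (show ((g : ℕ) : ℤ) * (((x 0 : ℕ) : ℤ) * (q 1 : ℕ) - ((x 1 : ℕ) : ℤ) * (q 0 : ℕ)) =
      ((g : ℕ) : ℤ) * (((y 0 : ℕ) : ℤ) * (q 1 : ℕ) - ((y 1 : ℕ) : ℤ) * (q 0 : ℕ)) by linear_combination h)
    exact this
  -- the integer multiplier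
  set k : ℤ := c₀ * (((x 0 : ℕ) : ℤ) - (y 0 : ℕ)) + c₁ * (((x 1 : ℕ) : ℤ) - (y 1 : ℕ)) with hk
  have hk0 : ((x 0 : ℕ) : ℤ) - (y 0 : ℕ) = k * (q 0 : ℕ) := by rw [hk]; linear_combination (-(((x 0 : ℕ) : ℤ) - (y 0 : ℕ))) * hbez + c₁ * h'
  have hk1 : ((x 1 : ℕ) : ℤ) - (y 1 : ℕ) = k * (q 1 : ℕ) := by rw [hk]; linear_combination (-(((x 1 : ℕ) : ℤ) - (y 1 : ℕ))) * hbez - c₀ * h'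
  have hcoord : ∀ c : Fin 2, ((x c : ℕ) : ℤ) - (y c : ℕ) = k * (q c : ℕ) := by
    intro c; fin_cases c; exact hk0; exact hk1
  rcases le_or_gt 0 k with hk' | hk'
  · left
    refine ⟨k.toNat, Finsupp.ext fun c => ?_⟩
    have h1 := hcoord c
    rw [Finsupp.add_apply, Finsupp.smul_apply, smul_eq_mul]
    have : ((x c : ℕ) : ℤ) = (y c : ℕ) + (k.toNat : ℤ) * (q c : ℕ) := by rw [Int.toNat_of_nonneg hk']; linarith
    exact_mod_cast this
  · right
    refine ⟨(-k).toNat, Finsupp.ext fun c => ?_⟩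
    have h1 := hcoord c
    rw [Finsupp.add_apply, Finsupp.smul_apply, smul_eq_mul]
    have : ((y c : ℕ) : ℤ) = (x c : ℕ) + ((-k).toNat : ℤ) * (q c : ℕ) := by rw [Int.toNat_of_nonneg (by omega)]; linarith
    exact_mod_cast this

/-- ★★ CANONICAL CLASS DATA at a vector `v ≠ 0`: a primitive step `q ∥ v` (`det(q, v) = 0`, and `det(s, v) = 0 ⟺ det(q, s) = 0`), bases `b` and multipliers
`n` with `e i = b i + n i • q` and `n i` MAXIMAL, so that the fibres of `b` are EXACTLY the v-resonance classes `det(e_i, v) = det(e_j, v)`. [folklore] -/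
theorem exists_toricW_classData {v : Expo} (hv : v ≠ 0) {K : ℕ} (e : Fin K → Expo) :
    ∃ (q : Expo) (b : Fin K → Expo) (n : Fin K → ℕ), idet q v = 0 ∧ (∀ s : Expo, idet s v = 0 ↔ idet q s = 0) ∧
      (∀ i, e i = b i + n i • q) ∧ (∀ i j, idet (e i) v = idet (e j) v ↔ b i = b j) := by
  -- the primitive vector
  set g : ℕ := Nat.gcd (v 0) (v 1) with hgdef
  have hg : 0 < g := by
    rw [hgdef]
    refine Nat.pos_of_ne_zero fun h => hv ?_
    obtain ⟨h0, h1⟩ := Nat.gcd_eq_zero_iff.mp h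
    ext c; fin_cases c; exact h0; exact h1
  set q : Expo := Finsupp.equivFunOnFinite.symm ![v 0 / g, v 1 / g] with hqdef
  have hq0 : q 0 = v 0 / g := by rw [hqdef]; rfl
  have hq1 : q 1 = v 1 / g := by rw [hqdef]; rfl
  have hvq : v = g • q := by
    ext c; fin_cases c
    · show v 0 = (g • q) 0
      rw [Finsupp.smul_apply, smul_eq_mul, hq0, Nat.mul_div_cancel' (Nat.gcd_dvd_left _ _)]
    · show v 1 = (g • q) 1
      rw [Finsupp.smul_apply, smul_eq_mul, hq1, Nat.mul_div_cancel' (Nat.gcd_dvd_right _ _)]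
  have hcop : Nat.Coprime (q 0) (q 1) := by rw [hq0, hq1]; exact Nat.coprime_div_gcd_div_gcd hg
  have hqne : q ≠ 0 := by intro h; apply hv; rw [hvq, h, smul_zero]
  have hidet : ∀ s : Expo, idet s v = (g : ℤ) * idet s q := by
    intro s; unfold idet; rw [hvq]; simp only [Finsupp.smul_apply, smul_eq_mul, Nat.cast_mul]; ring
  have hqv : idet q v = 0 := by rw [hidet]; unfold idet; ring
  -- maximal multipliers
  have hbound : ∀ (i : Fin K) (m : ℕ), m • q ≤ e i → m ≤ e i 0 + e i 1 := by
    intro i m hm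
    have h0 : m * q 0 ≤ e i 0 := by have := hm 0; rwa [Finsupp.smul_apply, smul_eq_mul] at this
    have h1 : m * q 1 ≤ e i 1 := by have := hm 1; rwa [Finsupp.smul_apply, smul_eq_mul] at this
    by_cases hq : q 0 = 0
    · have : q 1 ≠ 0 := by
        intro h; apply hqne; ext c; fin_cases c; exact hq; exact h
      nlinarith [Nat.pos_of_ne_zero this]
    · nlinarith [Nat.pos_of_ne_zero hq]
  let n : Fin K → ℕ := fun i => Nat.findGreatest (fun m => m • q ≤ e i) (e i 0 + e i 1)
  have hnle : ∀ i, n i • q ≤ e i := fun i =>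
    Nat.findGreatest_spec (P := fun m => m • q ≤ e i) (m := 0) (n := e i 0 + e i 1) (Nat.zero_le _) (by rw [zero_smul]; exact fun c => Nat.zero_le _)
  have hnmax : ∀ (i : Fin K) (m : ℕ), m • q ≤ e i → m ≤ n i := fun i m hm =>
    Nat.le_findGreatest (P := fun m => m • q ≤ e i) (hbound i m hm) hm
  refine ⟨q, fun i => e i - n i • q, n, hqv, fun s => ?_, fun i => (tsub_add_cancel_of_le (hnle i)).symm, fun i j => ⟨fun h => ?_, fun h => ?_⟩⟩
  · rw [hidet, mul_eq_zero, idet]; unfold idet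
    constructor
    · rintro (h | h)
      · exact absurd h (by exact_mod_cast hg.ne')
      · linarith
    · intro h; right; linarith
  · -- fullness: a resonant pair differs by `k • q`, and maximality pins the bases
    have key : ∀ i j : Fin K, ∀ k : ℕ, e i = e j + k • q → e i - n i • q = e j - n j • q := by
      intro i j k hk
      have h1 : n j + k ≤ n i := hnmax i _ (by rw [add_smul, hk]; exact add_le_add (hnle j) le_rfl)
      have h2 : n i - k ≤ n j := hnmax j _ (by
        have : (n i - k) • q + k • q ≤ e j + k • q := by rw [← add_smul, Nat.sub_add_cancel (by omega), ← hk]; exact hnle i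
        exact le_of_add_le_add_right this)
      have h3 : n i = n j + k := by omega
      rw [hk, h3, add_smul, add_tsub_add_eq_tsub_right]
    rcases expo_sub_parallel hg hvq hcop h with ⟨k, hk⟩ | ⟨k, hk⟩
    · exact key i j k hk
    · exact (key j i k hk).symm
  · have h' : e i - n i • q = e j - n j • q := h
    have hi := (tsub_add_cancel_of_le (hnle i)).symm
    have hj := (tsub_add_cancel_of_le (hnle j)).symm
    rw [hi, hj, idet_add_nsmul_left, idet_add_nsmul_left, hqv, mul_zero, mul_zero, add_zero, add_zero, h']

/-! ### §2 Merge-free families: every edge direction of `W` is a pair direction of `supp u` -/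

/-- `(u, e)` is MERGE-FREE (strong, uniform form): for every two non-zero support vectors `v, p` of `u` with `det(p, v) ≠ 0`, two columns NOT resonant at
`v` never satisfy `det(e_j, v) − det(e_i, v) + k·det(p, v) = 0` with an integer `|k| < K` — no v-class is hit by another one modulo small multiples of a
second support vector (val-idea-crit-8 g6 #118: the MERGE `det(e_{i′} − e_i − j•p, v) = 0`, `|j| <` class size; here `|k| < K` and all pairs `(v, p)`,
a stronger but K-UNIFORM genericity condition).  The only new `Prop`-definition of the W4 files (#118 (c)). [folklore] -/
def MergeFree (u : Poly2) {K : ℕ} (e : Fin K → Expo) : Prop :=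
  ∀ v ∈ S1 u, ∀ p ∈ S1 u, idet p v ≠ 0 → ∀ i j : Fin K, idet (e i) v ≠ idet (e j) v →
    ∀ k : ℤ, |k| < K → idet (e j) v - idet (e i) v + k * idet p v ≠ 0

/-- in a chart direction outside `Xc σ u`, the non-zero support points of `u` have pairwise distinct weights. [folklore] -/
theorem eq_of_wt_eq_of_notMem_Xc {σ : ℝ} (hσ : σ = 1 ∨ σ = -1) {μ : ℝ} {u : Poly2} (hμ : μ ∉ Xc σ u) {a b : Expo}
    (ha : a ∈ S1 u) (hb : b ∈ S1 u) (h : wt (dir σ μ) a = wt (dir σ μ) b) : a = b := by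
  by_cases h0 : a 0 = b 0
  · exact eq_of_wt_eq hσ h0 h
  · exfalso; apply hμ
    unfold Xc
    apply Finset.mem_union_left
    rw [Finset.mem_image]
    exact ⟨(a, b), Finset.mem_filter.mpr ⟨Finset.mem_product.mpr ⟨ha, hb⟩, h0⟩, (wt_eq_imp_cross h0 h).symm⟩

/-- two equal columns kill the Wronskian. [folklore] -/
theorem toricW_eq_zero_of_eq (u : Poly2) {K : ℕ} (e : Fin K → Expo) {i j : Fin K} (hij : i ≠ j) (h : e i = e j) :
    wronskian (⇑(jacDer u)) (fun i => monomial (e i) (1 : ℂ)) = 0 := by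
  rw [wronskian_def]
  exact Matrix.det_zero_of_column_eq hij fun k => by rw [wronskianMatrix_apply, wronskianMatrix_apply, h]

/-- ★★ **(W4c) MERGE-FREE FAMILIES KEEP THE PAIR DIRECTIONS OF `supp u`:** if `(u, e)` is merge-free then every edge direction of the toric Wronskian
`W_{J(·,u)}(X^{e_0},…,X^{e_{K−1}})` (in the chart `σ`) lies in the exceptional set `Xc σ u` of the carrier (crossing values of pairs of non-zero support
points + axis values) — INDEPENDENTLY of `K` and of the exponents `e`.  Proof: outside `Xc σ u` the normalised carrier `u − u(0)` has a unique top `v` and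
pairwise distinct weights; if no two columns resonate at `v`, ✓ `toricW_isUniqueTop_corner`; otherwise take the canonical class data at `v`
(`exists_toricW_classData`), the heaviest support point `p` off the line `ℝv` (if none, `W = 0` by ✓ `toricW_support_layer`), and the located point
`Σe + m•v + d•p` is the unique top by ✓ `toricW_isUniqueTop_layer`, its coefficient being the hybrid Vandermonde of ✓ `toricW_layer_closed_form`, whose
in-class factors are `u_p·(n_j − n_i)·det(q,p) ≠ 0` and whose cross factors are non-zero by merge-freeness. -/
theorem toricW_Eset_subset_Xc_of_mergeFree {σ : ℝ} (hσ : σ = 1 ∨ σ = -1) (u : Poly2) {K : ℕ} (e : Fin K → Expo) (hmf : MergeFree u e) :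
    Eset σ (wronskian (⇑(jacDer u)) (fun i => monomial (e i) (1 : ℂ))) ⊆ Xc σ u := by
  rw [← jacDer_sub_C u (coeff 0 u)]
  set u' : Poly2 := u - C (coeff 0 u) with hu'
  intro μ hμ
  by_contra hμX
  have hW := (mem_Eset hσ).mp hμ
  set ν : Fin 2 → ℝ := dir σ μ with hν
  have hsupp : u'.support ⊆ S1 u := fun s hs => mem_S1.mpr (mem_support_sub_C_coeff_zero hs)
  -- the degenerate carrier
  by_cases hu0 : u' = 0
  · have h := toricW_Eset_subset_of_generic hσ u' e (fun s hs => by rw [hu0, support_zero] at hs; exact absurd hs (Finset.notMem_empty _)) hμ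
    rw [hu0, Eset_zero] at h
    exact absurd h (Finset.notMem_empty _)
  -- `W ≠ 0`, so the columns are pairwise distinct
  obtain ⟨z, hz, -⟩ := hW
  have hWne : wronskian (⇑(jacDer u')) (fun i => monomial (e i) (1 : ℂ)) ≠ 0 := fun h => by
    rw [h, support_zero] at hz; exact absurd hz (Finset.notMem_empty _)
  have hinj : ∀ i j : Fin K, e i = e j → i = j := fun i j h => by
    by_contra hne; exact hWne (toricW_eq_zero_of_eq u' e hne h)
  have hW := (mem_Eset hσ).mp hμ
  -- the unique top `v ≠ 0` of the normalised carrier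
  have hνu : ¬ IsEdgeDir ν u' := fun h => hμX (toricW_Eset_subset_Xc_of_support hσ hsupp ((mem_Eset hσ).mpr h))
  obtain ⟨v, hv⟩ := exists_isUniqueTop_of_not_isEdgeDir hu0 hνu
  have hvS : v ∈ S1 u := hsupp hv.1
  have hv0 : v ≠ 0 := (mem_S1.mp hvS).2
  -- Case A: no resonance at `v` — the corner survives
  by_cases hres : ∀ i j : Fin K, idet (e i) v = idet (e j) v → i = j
  · exact not_tie_of_utop ((isUniqueTop_iff _ _ _).mp (toricW_isUniqueTop_corner hv e hres)) ((isEdgeDir_iff_tie _ _).mp hW)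
  -- Case B: canonical class data at `v`, defect `d ≥ 1`
  obtain ⟨q, b, n, hqv, hqs, he, hfull⟩ := exists_toricW_classData hv0 e
  have hd : 1 ≤ toricWDefect b := by
    simp only [not_forall] at hres
    obtain ⟨i, j, hij, hne⟩ := hres
    have hb : b i = b j := (hfull i j).mp hij
    unfold toricWDefect
    refine Finset.card_pos.mpr ?_
    rcases lt_or_gt_of_ne hne with h | h
    · exact ⟨(i, j), Finset.mem_filter.mpr ⟨Finset.mem_univ _, h, hb⟩⟩
    · exact ⟨(j, i), Finset.mem_filter.mpr ⟨Finset.mem_univ _, h, hb.symm⟩⟩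
  by_cases hcol : ∀ s ∈ u'.support, idet q s = 0
  · -- Case B1: every letter is collinear with `v`: no word can reach depth `d ≥ 1`, so `W = 0`
    obtain ⟨w, hw, -, hdw, -⟩ := toricW_support_layer u' q e b n he hz
    rw [Multiset.filter_eq_nil.mpr (fun s hs => not_not.mpr (hcol s (hw s hs))), Multiset.card_zero] at hdw
    omega
  -- Case B2: `p` = the heaviest letter off the line `ℝv`
  simp only [not_forall] at hcol
  obtain ⟨s₀, hs₀, hqs₀⟩ := hcol
  obtain ⟨p, hpmem, hpmax⟩ := Finset.exists_max_image (u'.support.filter fun s => idet q s ≠ 0) (wt ν)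
    ⟨s₀, Finset.mem_filter.mpr ⟨hs₀, hqs₀⟩⟩
  obtain ⟨hp, hqp⟩ := Finset.mem_filter.mp hpmem
  have hpS : p ∈ S1 u := hsupp hp
  have hpv' : p ≠ v := fun h => hqp (by rw [h, ← hqs v]; unfold idet; ring)
  have hpv : wt ν p < wt ν v := hv.2 p hp hpv'
  have hp2 : ∀ s ∈ u'.support, s ≠ p → idet q s ≠ 0 → wt ν s < wt ν p := fun s hs hsp hq =>
    lt_of_le_of_ne (hpmax s (Finset.mem_filter.mpr ⟨hs, hq⟩)) fun h => hsp (eq_of_wt_eq_of_notMem_Xc hσ hμX (hsupp hs) hpS h)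
  have hγ : idet p v ≠ 0 := fun h => hqp ((hqs p).mp h)
  obtain ⟨m, hm⟩ : ∃ m, m + toricWDefect b = ∑ i : Fin K, (i : ℕ) := ⟨_, Nat.sub_add_cancel (toricWDefect_le b)⟩
  -- the layer coefficient is the hybrid Vandermonde, factor by factor non-zero
  have hnz : coeff ((∑ i, e i) + m • v + toricWDefect b • p) (wronskian (⇑(jacDer u')) (fun i => monomial (e i) (1 : ℂ))) ≠ 0 := by
    rw [toricW_layer_closed_form hv hpv hp2 hqv hγ e b n he hm]
    refine Finset.prod_ne_zero_iff.mpr fun i _ => Finset.prod_ne_zero_iff.mpr fun j hj => ?_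
    have hij : i < j := Finset.mem_Ioi.mp hj
    by_cases hb : b i = b j
    · -- in-class factor: `u_p · (n_j − n_i) · det(q, p)`
      rw [if_pos hb]
      refine mul_ne_zero (MvPolynomial.mem_support_iff.mp hp) (sub_ne_zero.mpr fun h => ?_)
      have hn : n i ≠ n j := fun hn => absurd (hinj i j (by rw [he i, he j, hb, hn])) (ne_of_lt hij)
      rw [he j, he i, hb, idet_add_nsmul_left, idet_add_nsmul_left] at h
      have h' : ((n j : ℕ) : ℤ) * idet q p = ((n i : ℕ) : ℤ) * idet q p := add_left_cancel (Int.cast_injective h)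
      exact hn (by exact_mod_cast (mul_right_cancel₀ hqp h').symm)
    · -- cross-class factor: `u_v · (det(e_j,v) − det(e_i,v) + (ℓ_j − ℓ_i)·det(p,v))`, non-zero by merge-freeness
      rw [if_neg hb]
      have hres' : idet (e i) v ≠ idet (e j) v := fun h => hb ((hfull i j).mp h)
      have hk : |((toricWRank b j : ℤ) - (toricWRank b i : ℤ))| < K := by
        have h1 := (toricWRank_lt_card b i).trans_le (Finset.card_le_univ _)
        have h2 := (toricWRank_lt_card b j).trans_le (Finset.card_le_univ _)
        rw [Fintype.card_fin] at h1 h2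
        rw [abs_lt]; constructor <;> omega
      have hm' := hmf v hvS p hpS hγ i j hres' _ hk
      have huv : coeff v u' ≠ 0 := MvPolynomial.mem_support_iff.mp hv.1
      unfold toricWCornerWt
      intro h0
      apply hm'
      apply (Int.cast_injective (α := ℂ))
      have h1 : coeff v u' * ((((idet (e j) v - idet (e i) v + ((toricWRank b j : ℤ) - (toricWRank b i : ℤ)) * idet p v : ℤ)) : ℂ)) = 0 := by
        push_cast; linear_combination h0
      rcases mul_eq_zero.mp h1 with h | h
      · exact absurd h huv
      · rw [h]; push_cast; ring
  obtain ⟨-, hnot⟩ := toricW_isUniqueTop_layer hv hpv hp2 e b n he hm hnz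
  exact hnot hW

/-- ★ **THE K-FREE COUNT:** for a merge-free `(u, e)` with a `t`-sparse carrier, `|Eset σ W| ≤ t² + t` — uniformly in `K` and in all exponents. -/
theorem toricW_card_Eset_le_of_mergeFree {σ : ℝ} (hσ : σ = 1 ∨ σ = -1) {t : ℕ} (u : Poly2) (hu : u.support.card ≤ t) {K : ℕ} (e : Fin K → Expo)
    (hmf : MergeFree u e) : (Eset σ (wronskian (⇑(jacDer u)) (fun i => monomial (e i) (1 : ℂ)))).card ≤ t * t + t :=
  (Finset.card_le_card (toricW_Eset_subset_Xc_of_mergeFree hσ u e hmf)).trans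
    ((card_Xc_le σ u).trans (Nat.add_le_add (Nat.mul_le_mul hu hu) hu))

end TowerKernel

end Summit.ValiantsHypothesis.ValiantsHypothesis.Theorems.TwoProducts.RankTwoJacobian

end
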